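import Summits.AtomisticToContinuum.Crystallization.Theorems.FrustratedLawDichotomyStrainedPatchHomEntryLeafHTUCross090

/-!
# The fused certificate COMPOSES WITH THE LANDED INNER TREES FOR FREE: the `0.9 t_b` cell through the reduced-universe leaf with the 4-leaf min-pairs inner tree of record
# (27623 `(H) HomFloor (1/625)`, hcp half; hand-1 g32; critic rows 1228 (b) «deeper-split leaf» / 1236 (ii) inner-leaf multiplicity `m`)

decomp-a2c hand-1 g32 (crux `AperiodicFrustratedLawGap`, stmt-AtomisticToContinuum-27623).  The re-issued certificate `pX90U` of `…HTUCross090` differs from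
`pX90` ONLY in `Gs`, and the confined box `htWr` does not read `Gs` — so `htWr pX90U cX90 wX = htWr pX90 cX90 wX` by `rfl`, and EVERY inner-tree kernel
fact of record on that box transports to the reduced-universe leaf with no new kernel work.  Instance: the 4-leaf min-pairs inner tree `tX4` of
`…Cross090C.treeOKDM_X90` (66 s, hand-1 g31) gives ★★ `entryLeafOKHT4UQDM_X90 : entryLeafOKHT4U (entryLeafOKHQDM muRec) pX90U tX4 cX90 wX = true` — a
DEEPER-SPLIT leaf (`m = 4` inner leaves) at the `0.9 t_b` cell: `T′ = 108 s` (one-fact certificate side, `…HTUCross090.htCertSideU_X90`) `+ 66 s` (inner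
tree), sound by `…HTU.entryLeafOKHT4U_sound` with `…MinPairsLeaf.entryLeafOKHQDM_sound`.

Assembly by rewriting; 0 sorry; no definitions; standard axioms.  `--supports stmt-AtomisticToContinuum-27623`.
-/

namespace Summit.AtomisticToContinuum.Crystallization.Theorems.FrustratedLawDichotomyStrainedPatchHomEntryLeafHT

open Literature.Analysis.ValidatedNumerics.Numerics
open Summit.AtomisticToContinuum.Crystallization.Theorems.FrustratedLawDichotomyStrainedPatchHomCertTree (CertTree treeOK)
open Summit.AtomisticToContinuum.Crystallization.Theorems.FrustratedLawDichotomyStrainedPatchHomEntryTable (muRec)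
open Summit.AtomisticToContinuum.Crystallization.Theorems.FrustratedLawDichotomyStrainedPatchHomEntryFitHcpCentred (entryLeafOKHQDM)

/-- The confined box does not read `Gs`: the re-issued certificate has the same rounded confined box. [formal bookkeeping] -/
theorem htWr_pX90U : htWr pX90U cX90 wX = htWr pX90 cX90 wX := rfl

/-- ★★ **DEEPER-SPLIT LEAF FOR FREE**: the fused one-fact certificate side of `pX90U` and the landed 4-leaf min-pairs inner tree close the `0.9 t_b` cell
through the reduced-universe leaf. [assembly by rewriting: `htCertSideU_X90`, `htWr_pX90U`, `…Cross090C.treeOKDM_X90`] -/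
theorem entryLeafOKHT4UQDM_X90 : entryLeafOKHT4U (entryLeafOKHQDM muRec) pX90U tX4 cX90 wX = true := by
  have h1 := htCertSideU_X90
  have h2 := treeOKDM_X90
  unfold entryLeafOKHT4U
  rw [h1, htWr_pX90U, h2]
  rfl

end Summit.AtomisticToContinuum.Crystallization.Theorems.FrustratedLawDichotomyStrainedPatchHomEntryLeafHT
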